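import Summits.QuantumFields.BalabanUV.Beta.GAN24.DirichletVertexChart

/-!
# `BalabanUV.Beta.GAN24.DirichletVertexPullback` — binder row G-an2-4 / (CONV-C), road P2 PART IV, leaf L14 (the torus transfer), FILE A2:
# THE TRUNCATED PULL-BACK OF A DIRICHLET FIELD AT A RE-ENTRANT VERTEX — `hU`, `hEq`, the bond comparison, and the sum comparisons
# (unit b2b-balaban-gan24-p2, gen 26, v1)

HONEST FRAMING (cell contract, verbatim): «discharging `BetaPertH` makes Bałaban's UV stability UNCONDITIONAL — a real constructive-QFT
result; it is NOT the continuum limit and NOT the Clay problem.»  SUPPLIER module under the T⁴-DAG sub-row `T4-U1a.S-NE2-D1-DIRICHLET°`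
(holder: the t4-ne2-p1 lineage; owner wording R24 «the full rate L⁻¹ beyond boxes OPEN»).  Continuation of FILE A `DirichletVertexChart`
(the chart `emb σ b`, the pull-backs `Up`/`Uc`, the dictionary): here the hypotheses `hU`, `hEq` of the model ENDs
(`DirichletRingDecay.ring_energy_decay`, `DirichletRingWeighted.weighted_ring_energy_le`, `DirichletRingHessian.weighted_hessian_le`) are
produced for the truncated pull-back `Uc u` of ANY torus field `u` vanishing off `Ω = blockReg n M S` at a re-entrant vertex `(σ, b)`, and the
two right-hand quantities of those ENDs — the ring energy `Et (Uc u) K` and the source square-sum `sqSum ‖G‖² K` — are compared with the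
torus energy `Σ_μ ‖∂_μ u‖²` and the second-difference budget `Σ_{x ∈ Ω} ‖(Δu)(x)‖²` (memo `gen25/RING-LEMMA-KERNEL.md` §7 items (c), (d)).

## Contents ([folklore] finite sums; 0 sorry)

* §1 for `u` vanishing off `Ω` at a re-entrant `(σ, b)`: `Up u = 0` on `[0, n)²`; NO TRUNCATED NEIGHBOUR ENTERS (`Uc_nbrs_eq`); hence
  `lap (Uc u) = lap (Up u) = (LapS u ∘ emb)/n²` and `d_μ (Uc u) = d_μ (Up u)` on `[−n, n)² ∖ quadrant` (= `hEq` with source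
  `G = (LapS u ∘ emb)/n²`); the termwise BOND COMPARISON `hb (Uc u) i j ≤ hb (Up u) i j` (`j < n`), `vb` (`i < n`).
* §2 the ring energy in rectangular form and **`Et_Uc_le`**: for `K ≤ n` with `2K + 2 ≤ n·M_ν` (no wrap),
  `Et (Uc u) K ≤ (‖∂₀ u‖² + ‖∂₁ u‖²)/n²` (every model bond meeting `Q_K` is a distinct torus bond, `emb_injOn`).
* §3 the source: `Gc u (i, j) := 𝟙_{off-quadrant}·(LapS u)(emb i j)/n²` and **`sqSum_Gc_le`**: for `K ≤ n` with `2K ≤ n·M_ν`,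
  `sqSum ‖Gc u‖² K ≤ (Σ_{x ∈ Ω} ‖(LapS u)(x)‖²)/n⁴` (the off-quadrant window sites are distinct sites of `Ω`).

ABSOLUTE RULE (cell, verbatim): «No internally-minted statement may enter as a cited fact. Every hypothesis is either kernel-proved in
this package or a verbatim quotation of a PUBLISHED theorem with page reference. The manuscript(s) under audit are NOT citable for
their own disputed steps — they are the thing under adjudication; programme-internal (2001/route/tribunal) claims are never citable.»
Nothing printed is a hypothesis; no estimate of any Bałaban object is made here.  NOT CLAIMED: (A)/(B) on the torus (next files), the
weighted END p234489 (CONDITIONAL), the vector layer, NE2, (CONV-C) as a whole, `BetaPertH`, continuum, Clay.  «not in print; our proof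
attempt».  HONEST DEPENDENCY: continuum YM on T⁴ ⇐ BetaPertH ∧ nine spine estimates (0/9 proved); BetaPertH ⇐ (D1) ∧ (D4) ∧ CAP+tail;
G-an2-4 gates asym, D1 and NE2/3/4.
-/

noncomputable section

open scoped BigOperators ComplexConjugate Matrix
open Finset

namespace Summit.QuantumFields.BalabanUV.Beta.GAN24.DirichletVertexPullback

open Literature.MathematicalPhysics.QuantumFieldTheory.Balaban1983to89.B5Prop11Plancherel (Tor fine unitVec)
open Literature.MathematicalPhysics.QuantumFieldTheory.Balaban1983to89.B5Action121 (sdiff LapS sdiff_mulVec LapS_mulVec)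
open Literature.MathematicalPhysics.QuantumFieldTheory.Balaban1983to89.B5Prop11Lower (nsq nsq_nonneg)
open Summit.QuantumFields.BalabanUV.Beta.GAN24.DirichletBoxRegularity (Pdir Pdir_mulVec)
open Summit.QuantumFields.BalabanUV.Beta.GAN24.DirichletBoxTrace (blockReg)
open DirichletRingEnergies (hb vb lap En EH EV Tan Rad Et sqSum hb_nonneg vb_nonneg sqSum_nonneg)
open DirichletRingHessianIdentity (d1 d2)
open DirichletVertexChart

variable (n : ℕ) [NeZero n] (M : Fin 2 → ℕ) [hM : ∀ μ, NeZero (M μ)]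

/-! ## §1 Fields vanishing off the block region at a re-entrant vertex: `hU`, `hEq`, and the bond comparison -/

section Region

variable {S : Tor M → Prop} {σ : Fin 2 → Bool} {b : Tor M} {u : Tor (fine n M) → ℂ}

/-- the periodic pull-back of a field vanishing off `Ω = blockReg S` vanishes on the quadrant block `[0, n)²`. [folklore] -/
theorem Up_eq_zero_of_quadrant (hu : ∀ x, ¬ blockReg n M S x → u x = 0) (hre : ReentrantAt M S σ b) {i j : ℤ}
    (hi : 0 ≤ i) (hi' : i < n) (hj : 0 ≤ j) (hj' : j < n) : Up n M σ b u i j = 0 :=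
  hu _ (not_blockReg_emb n M hre hi hi' hj hj')

/-- **no truncated neighbour enters**: for `(i, j) ∈ [−n, n)² ∖ Q` every lattice neighbour of `(i, j)` that lies in the quadrant lies in
`[0, n)²`, where `Up u = 0`; hence `Uc u` and `Up u` agree at `(i, j)` and at its four neighbours. [folklore] -/
theorem Uc_nbrs_eq (hu : ∀ x, ¬ blockReg n M S x → u x = 0) (hre : ReentrantAt M S σ b) {i j : ℤ}
    (hi : -(n : ℤ) ≤ i) (hi' : i < n) (hj : -(n : ℤ) ≤ j) (hj' : j < n) (hq : ¬ (0 ≤ i ∧ 0 ≤ j)) :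
    Uc n M σ b u i j = Up n M σ b u i j ∧ Uc n M σ b u (i + 1) j = Up n M σ b u (i + 1) j
      ∧ Uc n M σ b u (i - 1) j = Up n M σ b u (i - 1) j ∧ Uc n M σ b u i (j + 1) = Up n M σ b u i (j + 1)
      ∧ Uc n M σ b u i (j - 1) = Up n M σ b u i (j - 1) := by
  have key : ∀ i' j' : ℤ, (0 ≤ i' ∧ 0 ≤ j' → i' < n ∧ j' < n) → Uc n M σ b u i' j' = Up n M σ b u i' j' := by
    intro i' j' h
    by_cases hq' : 0 ≤ i' ∧ 0 ≤ j'
    · rw [Uc, if_pos hq', Up_eq_zero_of_quadrant n M hu hre hq'.1 (h hq').1 hq'.2 (h hq').2]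
    · exact Uc_of_not n M σ b u hq'
  refine ⟨key i j fun h => absurd h hq, key (i + 1) j fun h => ⟨by omega, by omega⟩, key (i - 1) j fun h => by omega,
    key i (j + 1) fun h => ⟨by omega, by omega⟩, key i (j - 1) fun h => by omega⟩

/-- on `[−n, n)² ∖ Q` the Laplacians of the two pull-backs agree … [folklore] -/
theorem lap_Uc_eq (hu : ∀ x, ¬ blockReg n M S x → u x = 0) (hre : ReentrantAt M S σ b) {i j : ℤ}
    (hi : -(n : ℤ) ≤ i) (hi' : i < n) (hj : -(n : ℤ) ≤ j) (hj' : j < n) (hq : ¬ (0 ≤ i ∧ 0 ≤ j)) :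
    lap (Uc n M σ b u) i j = lap (Up n M σ b u) i j := by
  obtain ⟨h0, h1, h2, h3, h4⟩ := Uc_nbrs_eq n M hu hre hi hi' hj hj' hq
  rw [lap, lap, h0, h1, h2, h3, h4]

/-- … and so do the second differences `d1`, `d2`. [folklore] -/
theorem d1_Uc_eq (hu : ∀ x, ¬ blockReg n M S x → u x = 0) (hre : ReentrantAt M S σ b) {i j : ℤ}
    (hi : -(n : ℤ) ≤ i) (hi' : i < n) (hj : -(n : ℤ) ≤ j) (hj' : j < n) (hq : ¬ (0 ≤ i ∧ 0 ≤ j)) :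
    d1 (Uc n M σ b u) i j = d1 (Up n M σ b u) i j := by
  obtain ⟨h0, h1, h2, -, -⟩ := Uc_nbrs_eq n M hu hre hi hi' hj hj' hq
  rw [d1, d1, h0, h1, h2]

/-- second axis. [folklore] -/
theorem d2_Uc_eq (hu : ∀ x, ¬ blockReg n M S x → u x = 0) (hre : ReentrantAt M S σ b) {i j : ℤ}
    (hi : -(n : ℤ) ≤ i) (hi' : i < n) (hj : -(n : ℤ) ≤ j) (hj' : j < n) (hq : ¬ (0 ≤ i ∧ 0 ≤ j)) :
    d2 (Uc n M σ b u) i j = d2 (Up n M σ b u) i j := by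
  obtain ⟨h0, -, -, h3, h4⟩ := Uc_nbrs_eq n M hu hre hi hi' hj hj' hq
  rw [d2, d2, h0, h3, h4]

/-- **`hEq` FOR THE TRUNCATED PULL-BACK**: on `[−n, n)² ∖ Q`, `lap (Uc u) (i, j) = (Δ u)(emb σ b i j) / n²` — the model equation holds with
source `G = (Δu ∘ emb)/n²`, whatever `u` is off the window. [folklore] -/
theorem lap_Uc_eq_LapS (hu : ∀ x, ¬ blockReg n M S x → u x = 0) (hre : ReentrantAt M S σ b) {i j : ℤ}
    (hi : -(n : ℤ) ≤ i) (hi' : i < n) (hj : -(n : ℤ) ≤ j) (hj' : j < n) (hq : ¬ (0 ≤ i ∧ 0 ≤ j)) :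
    lap (Uc n M σ b u) i j = (LapS (fine n M) (n : ℂ) *ᵥ u) (emb n M σ b i j) / (n : ℂ) ^ 2 := by
  have hn : (n : ℂ) ^ 2 ≠ 0 := pow_ne_zero 2 (by exact_mod_cast NeZero.ne n)
  rw [lap_Uc_eq n M hu hre hi hi' hj hj' hq, LapS_emb, mul_div_cancel_left₀ _ hn]

/-- **BOND COMPARISON, horizontal**: below the line `j = n` every horizontal bond energy of the truncated pull-back is at most that of the
periodic one (the only bond where they differ joins `(−1, j)` to the quadrant site `(0, j)`, `0 ≤ j < n`, where `Up u = 0`). [folklore] -/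
theorem hb_Uc_le (hu : ∀ x, ¬ blockReg n M S x → u x = 0) (hre : ReentrantAt M S σ b) {i j : ℤ} (hj' : j < n) :
    hb (Uc n M σ b u) i j ≤ hb (Up n M σ b u) i j := by
  simp only [hb, Uc, Up]
  by_cases hq : 0 ≤ i ∧ 0 ≤ j
  · rw [if_pos hq, if_pos ⟨by omega, hq.2⟩, sub_zero, norm_zero, zero_pow two_ne_zero]; positivity
  · rw [if_neg hq]
    by_cases hq' : 0 ≤ i + 1 ∧ 0 ≤ j
    · have hi0 : i + 1 = 0 := by omega
      have h0 : u (emb n M σ b 0 j) = 0 :=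
        Up_eq_zero_of_quadrant n M hu hre le_rfl (by have := NeZero.ne n; omega) hq'.2 hj'
      rw [if_pos hq', hi0, h0]
    · rw [if_neg hq']

/-- **BOND COMPARISON, vertical**: left of the line `i = n`, `vb (Uc u) (i, j) ≤ vb (Up u) (i, j)`. [folklore] -/
theorem vb_Uc_le (hu : ∀ x, ¬ blockReg n M S x → u x = 0) (hre : ReentrantAt M S σ b) {i j : ℤ} (hi' : i < n) :
    vb (Uc n M σ b u) i j ≤ vb (Up n M σ b u) i j := by
  simp only [vb, Uc, Up]
  by_cases hq : 0 ≤ i ∧ 0 ≤ j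
  · rw [if_pos hq, if_pos ⟨hq.1, by omega⟩, sub_zero, norm_zero, zero_pow two_ne_zero]; positivity
  · rw [if_neg hq]
    by_cases hq' : 0 ≤ i ∧ 0 ≤ j + 1
    · have hj0 : j + 1 = 0 := by omega
      have h0 : u (emb n M σ b i 0) = 0 :=
        Up_eq_zero_of_quadrant n M hu hre hq'.1 hi' le_rfl (by have := NeZero.ne n; omega)
      rw [if_pos hq', hj0, h0]
    · rw [if_neg hq']

end Region


/-! ## §2 The ring energy of the pull-back is a sub-sum of the torus energy -/

/-- the horizontal bonds meeting `Q_K`: rows `j = −K+t` (`t < 2K`), bonds `i = −K−1+s → i+1` (`s < 2K+1`). [folklore] -/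
def EtH (U : ℤ → ℤ → ℂ) (K : ℕ) : ℝ := ∑ t ∈ range (2 * K), ∑ s ∈ range (2 * K + 1), hb U (-(K : ℤ) - 1 + s) (-(K : ℤ) + t)

/-- the vertical bonds meeting `Q_K`: columns `i = −K+s` (`s < 2K`), bonds `j = −K−1+t → j+1` (`t < 2K+1`). [folklore] -/
def EtV (U : ℤ → ℤ → ℂ) (K : ℕ) : ℝ := ∑ s ∈ range (2 * K), ∑ t ∈ range (2 * K + 1), vb U (-(K : ℤ) + s) (-(K : ℤ) - 1 + t)

omit [NeZero n] hM in
/-- **the ring energy in rectangular form**: `Ẽ_K = Et U K = EtH U K + EtV U K` (the `2K(2K+1)` horizontal and as many vertical bonds meeting `Q_K`).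
[folklore] -/
theorem Et_eq_rect (U : ℤ → ℤ → ℂ) (K : ℕ) : Et U K = EtH U K + EtV U K := by
  rcases K with _ | k
  · simp [DirichletRingEnergies.Et_zero, EtH, EtV]
  have e1 : 2 * (k + 1) + 1 = (2 * k + 1) + 1 + 1 := by ring
  have e2 : 2 * (k + 1) - 1 = 2 * k + 1 := by omega
  have hH : EtH U (k + 1) = EH U (k + 1)
      + ∑ t ∈ range (2 * (k + 1)), (hb U (-((k + 1 : ℕ) : ℤ) - 1) (-((k + 1 : ℕ) : ℤ) + t) + hb U (((k + 1 : ℕ) : ℤ) - 1) (-((k + 1 : ℕ) : ℤ) + t)) := by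
    rw [EtH, EH, e2, ← sum_add_distrib]
    refine sum_congr rfl fun t _ => ?_
    rw [e1, sum_range_succ, sum_range_succ']
    have i1 : (-((k + 1 : ℕ) : ℤ) + ((2 * k + 1 : ℕ) : ℤ)) = ((k + 1 : ℕ) : ℤ) - 1 := by push_cast; ring
    have i2 : ∀ s : ℕ, (-((k + 1 : ℕ) : ℤ) - 1 + ((s + 1 : ℕ) : ℤ)) = -((k + 1 : ℕ) : ℤ) + s := fun s => by push_cast; ring
    simp only [i2, Nat.cast_zero, add_zero, i1]
    ring
  have hV : EtV U (k + 1) = EV U (k + 1)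
      + ∑ s ∈ range (2 * (k + 1)), (vb U (-((k + 1 : ℕ) : ℤ) + s) (-((k + 1 : ℕ) : ℤ) - 1) + vb U (-((k + 1 : ℕ) : ℤ) + s) (((k + 1 : ℕ) : ℤ) - 1)) := by
    rw [EtV, EV, e2, ← sum_add_distrib]
    refine sum_congr rfl fun t _ => ?_
    rw [e1, sum_range_succ, sum_range_succ']
    have i1 : (-((k + 1 : ℕ) : ℤ) + ((2 * k + 1 : ℕ) : ℤ)) = ((k + 1 : ℕ) : ℤ) - 1 := by push_cast; ring
    have i2 : ∀ s : ℕ, (-((k + 1 : ℕ) : ℤ) - 1 + ((s + 1 : ℕ) : ℤ)) = -((k + 1 : ℕ) : ℤ) + s := fun s => by push_cast; ring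
    simp only [i2, Nat.cast_zero, add_zero, i1]
    ring
  rw [Et, En, Rad, hH, hV]
  ring

omit [NeZero n] hM in
/-- `0 ≤ EtH`. [folklore] -/
theorem EtH_nonneg (U : ℤ → ℤ → ℂ) (K : ℕ) : 0 ≤ EtH U K := sum_nonneg fun _ _ => sum_nonneg fun _ _ => hb_nonneg U _ _

omit [NeZero n] hM in
/-- `0 ≤ EtV`. [folklore] -/
theorem EtV_nonneg (U : ℤ → ℤ → ℂ) (K : ℕ) : 0 ≤ EtV U K := sum_nonneg fun _ _ => sum_nonneg fun _ _ => vb_nonneg U _ _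

section Sums

variable {S : Tor M → Prop} {σ : Fin 2 → Bool} {b : Tor M} {u : Tor (fine n M) → ℂ}

/-- the bond shift of the orientation: the torus bond at `emb (i + bsh, j)` in direction `+e_0` is the model bond `(i, j) → (i+1, j)`. [folklore] -/
def bsh (σ : Fin 2 → Bool) (ν : Fin 2) : ℤ := if σ ν then 0 else 1

omit [NeZero n] hM in
/-- `0 ≤ bsh ≤ 1`. [folklore] -/
theorem bsh_mem (σ : Fin 2 → Bool) (ν : Fin 2) : 0 ≤ bsh σ ν ∧ bsh σ ν ≤ 1 := by
  unfold bsh; split_ifs <;> simp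

/-- the horizontal model bond as a torus bond: `hb (Up u) (i, j) = ‖(∂₀ u)(emb (i + bsh σ 0) j)‖²/n²`. [folklore] -/
theorem hb_Up_eq (σ : Fin 2 → Bool) (b : Tor M) (u : Tor (fine n M) → ℂ) (i j : ℤ) :
    hb (Up n M σ b u) i j = ‖(sdiff (fine n M) (n : ℂ) 0 *ᵥ u) (emb n M σ b (i + bsh σ 0) j)‖ ^ 2 / (n : ℝ) ^ 2 := by
  have hn : (n : ℝ) ^ 2 ≠ 0 := pow_ne_zero 2 (by exact_mod_cast NeZero.ne n)
  rw [normSq_sdiff_emb_fst, bsh]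
  by_cases h : σ 0
  · rw [if_pos h, if_pos h, add_zero, mul_div_cancel_left₀ _ hn]
  · rw [if_neg h, if_neg h, add_sub_cancel_right, mul_div_cancel_left₀ _ hn]

/-- the vertical model bond as a torus bond: `vb (Up u) (i, j) = ‖(∂₁ u)(emb i (j + bsh σ 1))‖²/n²`. [folklore] -/
theorem vb_Up_eq (σ : Fin 2 → Bool) (b : Tor M) (u : Tor (fine n M) → ℂ) (i j : ℤ) :
    vb (Up n M σ b u) i j = ‖(sdiff (fine n M) (n : ℂ) 1 *ᵥ u) (emb n M σ b i (j + bsh σ 1))‖ ^ 2 / (n : ℝ) ^ 2 := by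
  have hn : (n : ℝ) ^ 2 ≠ 0 := pow_ne_zero 2 (by exact_mod_cast NeZero.ne n)
  rw [normSq_sdiff_emb_snd, bsh]
  by_cases h : σ 1
  · rw [if_pos h, if_pos h, add_zero, mul_div_cancel_left₀ _ hn]
  · rw [if_neg h, if_neg h, add_sub_cancel_right, mul_div_cancel_left₀ _ hn]

/-- a double range sum of a nonnegative torus function along an injective parametrisation is at most the torus sum. [folklore] -/
theorem sum_sum_le_univ_of_injOn {A B : ℕ} (φ : ℕ → ℕ → Tor (fine n M)) (F : Tor (fine n M) → ℝ) (hF : ∀ x, 0 ≤ F x)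
    (hinj : ∀ a ∈ range A, ∀ c ∈ range B, ∀ a' ∈ range A, ∀ c' ∈ range B, φ a c = φ a' c' → a = a' ∧ c = c') :
    ∑ a ∈ range A, ∑ c ∈ range B, F (φ a c) ≤ ∑ x, F x := by
  classical
  rw [← sum_product']
  have hinj' : Set.InjOn (fun p : ℕ × ℕ => φ p.1 p.2) ↑(range A ×ˢ range B) := by
    rintro ⟨a, c⟩ hp ⟨a', c'⟩ hp' h
    simp only [coe_product, Set.mem_prod, mem_coe] at hp hp'
    obtain ⟨h1, h2⟩ := hinj a hp.1 c hp.2 a' hp'.1 c' hp'.2 h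
    rw [h1, h2]
  rw [← sum_image hinj']
  exact sum_le_univ_sum_of_nonneg hF

/-- **THE HORIZONTAL RING ENERGY IS A SUB-SUM OF `‖∂₀ u‖²/n²`**: for `2K + 2 ≤ n·M_0` and `2K ≤ n·M_1` (no wrap),
`EtH (Up u) K ≤ ‖∂₀ u‖²/n²`. [folklore] -/
theorem EtH_Up_le (σ : Fin 2 → Bool) (b : Tor M) (u : Tor (fine n M) → ℂ) {K : ℕ} (h0 : 2 * K + 2 ≤ n * M 0) (h1 : 2 * K ≤ n * M 1) :
    EtH (Up n M σ b u) K ≤ nsq (sdiff (fine n M) (n : ℂ) 0 *ᵥ u) / (n : ℝ) ^ 2 := by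
  have hn : (0 : ℝ) < (n : ℝ) ^ 2 := pow_pos (by exact_mod_cast Nat.pos_of_ne_zero (NeZero.ne n)) 2
  have hb01 := bsh_mem σ 0
  rw [EtH]
  simp only [hb_Up_eq, ← sum_div]
  refine div_le_div_of_nonneg_right ?_ hn.le
  rw [nsq]
  refine sum_sum_le_univ_of_injOn n M (fun t s => emb n M σ b (-(K : ℤ) - 1 + s + bsh σ 0) (-(K : ℤ) + t)) (fun x => ‖_‖ ^ 2)
    (fun _ => sq_nonneg _) ?_
  intro t ht s hs t' ht' s' hs' h
  simp only [mem_range] at ht hs ht' hs'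
  have := emb_injOn n M (σ := σ) (b := b) (a₀ := -(K : ℤ) - 1 + bsh σ 0) (a₁ := -(K : ℤ)) (W₀ := 2 * K + 2) (W₁ := 2 * K) h0 h1
    (i := -(K : ℤ) - 1 + s + bsh σ 0) (j := -(K : ℤ) + t) (i' := -(K : ℤ) - 1 + s' + bsh σ 0) (j' := -(K : ℤ) + t')
    (by omega) (by omega) (by omega) (by omega) (by omega) (by omega) (by omega) (by omega) h
  omega

/-- **THE VERTICAL RING ENERGY IS A SUB-SUM OF `‖∂₁ u‖²/n²**: for `2K ≤ n·M_0` and `2K + 2 ≤ n·M_1`, `EtV (Up u) K ≤ ‖∂₁ u‖²/n²`. [folklore] -/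
theorem EtV_Up_le (σ : Fin 2 → Bool) (b : Tor M) (u : Tor (fine n M) → ℂ) {K : ℕ} (h0 : 2 * K ≤ n * M 0) (h1 : 2 * K + 2 ≤ n * M 1) :
    EtV (Up n M σ b u) K ≤ nsq (sdiff (fine n M) (n : ℂ) 1 *ᵥ u) / (n : ℝ) ^ 2 := by
  have hn : (0 : ℝ) < (n : ℝ) ^ 2 := pow_pos (by exact_mod_cast Nat.pos_of_ne_zero (NeZero.ne n)) 2
  have hb01 := bsh_mem σ 1
  rw [EtV]
  simp only [vb_Up_eq, ← sum_div]
  refine div_le_div_of_nonneg_right ?_ hn.le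
  rw [nsq]
  refine sum_sum_le_univ_of_injOn n M (fun s t => emb n M σ b (-(K : ℤ) + s) (-(K : ℤ) - 1 + t + bsh σ 1)) (fun x => ‖_‖ ^ 2)
    (fun _ => sq_nonneg _) ?_
  intro s hs t ht s' hs' t' ht' h
  simp only [mem_range] at ht hs ht' hs'
  have := emb_injOn n M (σ := σ) (b := b) (a₀ := -(K : ℤ)) (a₁ := -(K : ℤ) - 1 + bsh σ 1) (W₀ := 2 * K) (W₁ := 2 * K + 2) h0 h1
    (i := -(K : ℤ) + s) (j := -(K : ℤ) - 1 + t + bsh σ 1) (i' := -(K : ℤ) + s') (j' := -(K : ℤ) - 1 + t' + bsh σ 1)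
    (by omega) (by omega) (by omega) (by omega) (by omega) (by omega) (by omega) (by omega) h
  omega

/-- **THE RING ENERGY OF THE TRUNCATED PULL-BACK IS AT MOST THE TORUS ENERGY / n²**: for `u` vanishing off `Ω` at a re-entrant `(σ, b)`,
`K ≤ n` and no wrap (`2K + 2 ≤ n·M_ν`): `Et (Uc u) K ≤ (‖∂₀ u‖² + ‖∂₁ u‖²)/n²`. [folklore] -/
theorem Et_Uc_le (hu : ∀ x, ¬ blockReg n M S x → u x = 0) (hre : ReentrantAt M S σ b) {K : ℕ} (hK : K ≤ n)
    (h0 : 2 * K + 2 ≤ n * M 0) (h1 : 2 * K + 2 ≤ n * M 1) :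
    Et (Uc n M σ b u) K ≤ (nsq (sdiff (fine n M) (n : ℂ) 0 *ᵥ u) + nsq (sdiff (fine n M) (n : ℂ) 1 *ᵥ u)) / (n : ℝ) ^ 2 := by
  rw [Et_eq_rect, add_div]
  refine add_le_add ?_ ?_
  · refine le_trans ?_ (EtH_Up_le n M σ b u h0 (by omega))
    rw [EtH, EtH]
    refine sum_le_sum fun t ht => sum_le_sum fun s _ => ?_
    simp only [mem_range] at ht
    exact hb_Uc_le n M hu hre (by omega)
  · refine le_trans ?_ (EtV_Up_le n M σ b u (by omega) h1)
    rw [EtV, EtV]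
    refine sum_le_sum fun s hs => sum_le_sum fun t _ => ?_
    simp only [mem_range] at hs
    exact vb_Uc_le n M hu hre (by omega)

/-! ## §3 The source of the model equation is a sub-sum of the second-difference budget on `Ω` -/

/-- the SOURCE of the pulled-back equation: `G(i, j) = (Δu)(emb σ b i j)/n²` off the quadrant, `0` on it. [folklore] -/
def Gc (σ : Fin 2 → Bool) (b : Tor M) (u : Tor (fine n M) → ℂ) (i j : ℤ) : ℂ :=
  if 0 ≤ i ∧ 0 ≤ j then 0 else (LapS (fine n M) (n : ℂ) *ᵥ u) (emb n M σ b i j) / (n : ℂ) ^ 2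

/-- **`hEq` WITH THE SOURCE `Gc`**: on `[−n, n)² ∖ quadrant`, `lap (Uc u) = Gc u`. [folklore] -/
theorem lap_Uc_eq_Gc (hu : ∀ x, ¬ blockReg n M S x → u x = 0) (hre : ReentrantAt M S σ b) :
    ∀ i j : ℤ, -(n : ℤ) ≤ i → i < n → -(n : ℤ) ≤ j → j < n → ¬ (0 ≤ i ∧ 0 ≤ j) → lap (Uc n M σ b u) i j = Gc n M σ b u i j :=
  fun _ _ hi hi' hj hj' hq => by rw [Gc, if_neg hq, lap_Uc_eq_LapS n M hu hre hi hi' hj hj' hq]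

/-- **THE SOURCE SQUARE-SUM IS A SUB-SUM OF THE SECOND-DIFFERENCE BUDGET**: for a re-entrant `(σ, b)`, `K ≤ n` and no wrap (`2K ≤ n·M_ν`):
`sqSum ‖Gc u‖² K ≤ (Σ_{x ∈ Ω} ‖(Δu)(x)‖²)/n⁴` (the off-quadrant window sites are distinct sites of `Ω`). [folklore] -/
theorem sqSum_Gc_le [DecidablePred S] (hre : ReentrantAt M S σ b) (u : Tor (fine n M) → ℂ) {K : ℕ} (hK : K ≤ n)
    (h0 : 2 * K ≤ n * M 0) (h1 : 2 * K ≤ n * M 1) :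
    sqSum (fun i j => ‖Gc n M σ b u i j‖ ^ 2) K
      ≤ (∑ x ∈ univ.filter (blockReg n M S), ‖(LapS (fine n M) (n : ℂ) *ᵥ u) x‖ ^ 2) / (n : ℝ) ^ 4 := by
  have hn0 : (0 : ℝ) < n := by exact_mod_cast Nat.pos_of_ne_zero (NeZero.ne n)
  have hn : (0 : ℝ) < (n : ℝ) ^ 4 := pow_pos hn0 4
  set F : Tor (fine n M) → ℝ := fun x => if blockReg n M S x then ‖(LapS (fine n M) (n : ℂ) *ᵥ u) x‖ ^ 2 else 0 with hF
  have hF0 : ∀ x, 0 ≤ F x := fun x => by rw [hF]; simp only; split_ifs <;> positivity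
  -- termwise: `‖Gc(i,j)‖² ≤ F(emb i j)/n⁴` on `Q_K`
  have hterm : ∀ t ∈ range (2 * K), ∀ s ∈ range (2 * K),
      ‖Gc n M σ b u (-(K : ℤ) + s) (-(K : ℤ) + t)‖ ^ 2 ≤ F (emb n M σ b (-(K : ℤ) + s) (-(K : ℤ) + t)) / (n : ℝ) ^ 4 := by
    intro t ht s hs
    simp only [mem_range] at ht hs
    rw [Gc, hF]
    simp only
    split_ifs with hq hΩ hΩ
    · rw [norm_zero, zero_pow two_ne_zero]; positivity
    · rw [norm_zero, zero_pow two_ne_zero]; positivity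
    · rw [norm_div, div_pow, norm_pow, Complex.norm_natCast, ← pow_mul]
    · exact absurd (blockReg_emb n M hre (by omega) (by omega) (by omega) (by omega) hq) hΩ
  calc sqSum (fun i j => ‖Gc n M σ b u i j‖ ^ 2) K
      ≤ ∑ t ∈ range (2 * K), ∑ s ∈ range (2 * K), F (emb n M σ b (-(K : ℤ) + s) (-(K : ℤ) + t)) / (n : ℝ) ^ 4 :=
        sum_le_sum fun t ht => sum_le_sum fun s hs => hterm t ht s hs
    _ = (∑ t ∈ range (2 * K), ∑ s ∈ range (2 * K), F (emb n M σ b (-(K : ℤ) + s) (-(K : ℤ) + t))) / (n : ℝ) ^ 4 := by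
        simp only [sum_div]
    _ ≤ (∑ x, F x) / (n : ℝ) ^ 4 := by
        refine div_le_div_of_nonneg_right ?_ hn.le
        refine sum_sum_le_univ_of_injOn n M (fun t s => emb n M σ b (-(K : ℤ) + s) (-(K : ℤ) + t)) F hF0 ?_
        intro t ht s hs t' ht' s' hs' h
        simp only [mem_range] at ht hs ht' hs'
        have := emb_injOn n M (σ := σ) (b := b) (a₀ := -(K : ℤ)) (a₁ := -(K : ℤ)) (W₀ := 2 * K) (W₁ := 2 * K) h0 h1
          (i := -(K : ℤ) + s) (j := -(K : ℤ) + t) (i' := -(K : ℤ) + s') (j' := -(K : ℤ) + t')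
          (by omega) (by omega) (by omega) (by omega) (by omega) (by omega) (by omega)
          (by omega) h
        omega
    _ = _ := by rw [hF, sum_filter]

/-- the same with the budget written as a sum over the subtype `{x // Ω x}` (the shape of M-C `sum_normSq_LapS_solExt_le`). [folklore] -/
theorem sqSum_Gc_le_subtype [DecidablePred S] (hre : ReentrantAt M S σ b) (u : Tor (fine n M) → ℂ) {K : ℕ} (hK : K ≤ n)
    (h0 : 2 * K ≤ n * M 0) (h1 : 2 * K ≤ n * M 1) :
    sqSum (fun i j => ‖Gc n M σ b u i j‖ ^ 2) K
      ≤ (∑ a : {x // blockReg n M S x}, ‖(LapS (fine n M) (n : ℂ) *ᵥ u) a‖ ^ 2) / (n : ℝ) ^ 4 := by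
  rw [← Finset.sum_subtype (univ.filter (blockReg n M S)) (fun x => by simp)
    (fun x => ‖(LapS (fine n M) (n : ℂ) *ᵥ u) x‖ ^ 2)]
  exact sqSum_Gc_le n M hre u hK h0 h1

end Sums

end Summit.QuantumFields.BalabanUV.Beta.GAN24.DirichletVertexPullback

end
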